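import Summits.MatrixMultiplication.MatrixMultiplication.Theorems.ObstructionDescentUniversalOccurrenceTwoRectangleFloor

set_option linter.dupNamespace false
set_option autoImplicit false

/-!
# Obstruction descent — universal occurrence: semi-invariance of two-rectangle pairings (K24)

Companion to the two-rectangle floor law
(`ObstructionDescentUniversalOccurrenceTwoRectangleFloor`).  There, occurrence of a type
`((δ^N),(δ^N),ν)` in a tensor power of the unit tensor `⟨m⟩`, `m ≥ N`, was derived from ONE non-zero
pairing of a joint highest-weight functional `ζ_e ⊗ ζ_{e'} ⊗ M` with a power of a DIAGONAL SLICE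
`t₀(c) = ∑ᵢ eᵢ ⊗ eᵢ ⊗ cᵢ`.  This file proves that nothing is lost by looking only at diagonal slices:

* `sum_powAct₁_mul`, `sum_powAct₂_mul` — the leg actions `A^{⊗D} ⊗ 1 ⊗ 1`, `1 ⊗ B^{⊗D} ⊗ 1` on tensor
  powers are adjoint, in the pairing `⟪X, f⟫ = ∑_{u v w} X u v w · f((u,v),w)`, to the transposed
  substitution in the corresponding word of the functional `f`;
* `sum_prod_mul_eq_det_pow_mul_of_mem_highestWeightSpace_rectangle` — a functional whose partial
  functions in a word lie in the rectangular highest-weight space `HW_{(δ^N)}` is a `det^δ`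
  SEMI-INVARIANT of the full group `GL_N` in that word (BLMW 2011, Prop. 5.2.1: `S_{(δ^N)} = det^δ`);
* `pairing_kroneckerPow_actTensor₁₂_of_rectangle` — hence for `f` with legs 1, 2 in `HW_{(δ^N)}` and
  invertible `A, B`:  `⟪f, ((A ⊗ B ⊗ 1)·s)^{⊗Nδ}⟫ = det(A)^δ · det(B)^δ · ⟪f, s^{⊗Nδ}⟫`;
* `actTensor_unitTensor_eq_actTensor_diagSlice` — every point of the `GL_N × GL_N × Mat_N`-orbit of
  `⟨N⟩` is `(A ⊗ B ⊗ 1)·t₀(c)` with `c i l = C l i`;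
* `pairing_orbit_unitTensor_of_rectangle`, `pairing_orbit_unitTensor_blockSign_blockSign` — so on
  the orbit of `⟨N⟩` every two-rectangle pairing is `det(A)^δ det(B)^δ` times the diagonal-slice
  pairing, which for `f = ζ_e ⊗ ζ_{e'} ⊗ M` is the explicit signed block sum of the floor law
  (`pairing_diagSlice_blockSign_blockSign`); and
* `pairing_orbit_unitTensor_eq_zero_iff_of_rectangle` — a two-rectangle highest-weight functional
  vanishes on (the `Nδ`-th powers of) the whole `GL_N × GL_N × Mat_N`-orbit of `⟨N⟩` iff it vanishes
  on all diagonal slices.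

This is the formal half of the statement «the floor test of the `u(N)`-programme on the
`SL_N × SL_N`-semi-invariant sector is complete»: occurrence of `((δ^N),(δ^N),ν)` for `⟨N⟩` is
decided by the values of finitely many explicit polynomials in an `N × N` matrix `c`.
-/

open scoped BigOperators

namespace Summit.MatrixMultiplication.MatrixMultiplication.Theorems.ObstructionCalculus

open Literature.Computability.AlgebraicComplexity
open Literature.NumberTheory.DiophantineGeometry (Word Word3 wordRep wordRep_apply highestWeightSpace Weight tripleHw
  mem_tripleHw_iff unimodularBorelInvariants_eq_highestWeightSpace)

/-! ### §1 Adjunction of the leg actions on tensor powers -/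

/-- A triple sum may be reordered so that the first index comes last. [folklore] -/
private theorem sum_sum_sum_rotate {α β γ : Type*} [Fintype α] [Fintype β] [Fintype γ]
    (G : α → β → γ → ℂ) : ∑ a, ∑ b, ∑ c, G a b c = ∑ b, ∑ c, ∑ a, G a b c := by
  rw [Finset.sum_comm]
  exact Finset.sum_congr rfl fun b _ => Finset.sum_comm

/-- **Adjunction for the first leg**: `⟪(A^{⊗D} ⊗ 1 ⊗ 1) X, f⟫ = ⟪X, f ∘₁ Aᵀ⟫, i.e.
`∑_{u v w} (A^{⊗D}X)(u,v,w) f((u,v),w) = ∑_{u v w} X(u,v,w) ∑_{u'} (∏_p A_{u' p, u p}) f((u',v),w)`. [folklore] -/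
theorem sum_powAct₁_mul {N D : ℕ} (A : Matrix (Fin N) (Fin N) ℂ)
    (X : Word N D → Word N D → Word N D → ℂ) (f : Word3 N D → ℂ) :
    ∑ u, ∑ v, ∑ w, powAct₁ A X u v w * f ((u, v), w) =
      ∑ u, ∑ v, ∑ w, X u v w * ∑ u', (∏ p, A (u' p) (u p)) * f ((u', v), w) := by
  simp only [powAct₁_apply, Finset.sum_mul, Finset.mul_sum]
  rw [sum_sum_sum_rotate (fun u' v w => ∑ u, (∏ p, A (u' p) (u p)) * X u v w * f ((u', v), w)),
    sum_sum_sum_rotate (fun u v w => ∑ u', X u v w * ((∏ p, A (u' p) (u p)) * f ((u', v), w)))]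
  refine Finset.sum_congr rfl fun v _ => Finset.sum_congr rfl fun w _ => ?_
  rw [Finset.sum_comm]
  exact Finset.sum_congr rfl fun u _ => Finset.sum_congr rfl fun u' _ => by ring

/-- **Adjunction for the second leg**: `⟪(1 ⊗ B^{⊗D} ⊗ 1) X, f⟫ = ⟪X, f ∘₂ Bᵀ⟫. [folklore] -/
theorem sum_powAct₂_mul {N D : ℕ} (B : Matrix (Fin N) (Fin N) ℂ)
    (X : Word N D → Word N D → Word N D → ℂ) (f : Word3 N D → ℂ) :
    ∑ u, ∑ v, ∑ w, powAct₂ B X u v w * f ((u, v), w) =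
      ∑ u, ∑ v, ∑ w, X u v w * ∑ v', (∏ p, B (v' p) (v p)) * f ((u, v'), w) := by
  simp only [powAct₂_apply, Finset.sum_mul, Finset.mul_sum]
  refine Finset.sum_congr rfl fun u _ => ?_
  rw [sum_sum_sum_rotate (fun v' w v => (∏ i, B (v' i) (v i)) * X u v w * f ((u, v'), w))]
  conv_rhs => rw [Finset.sum_comm]
  exact Finset.sum_congr rfl fun w _ => Finset.sum_congr rfl fun v _ =>
    Finset.sum_congr rfl fun v' _ => by ring

/-- Pulling a constant out of a pairing. [folklore] -/
private theorem sum_mul_const_mul {N D : ℕ} (a : ℂ) (P : Word N D → Word N D → Word N D → ℂ)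
    (f : Word3 N D → ℂ) :
    ∑ u, ∑ v, ∑ w, P u v w * (a * f ((u, v), w)) = a * ∑ u, ∑ v, ∑ w, P u v w * f ((u, v), w) := by
  simp only [Finset.mul_sum]
  exact Finset.sum_congr rfl fun _ _ => Finset.sum_congr rfl fun _ _ =>
    Finset.sum_congr rfl fun _ _ => by ring

/-! ### §2 Rectangular highest-weight functionals are `det^δ` semi-invariants of the full `GL_N` -/

/-- **`S_{(δ^N)}(ℂ^N) = det^δ` in coordinates**: if `y ∈ HW_{(δ^N)}((ℂ^N)^{⊗Nδ})` then for EVERY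
invertible `A`, `∑_{u'} (∏_p A_{u' p, u p}) y(u') = det(A)^δ y(u)` (the transposed substitution; BLMW 2011,
proof of Prop. 5.2.1, via the tree's `wordRep_eq_det_pow_smul_of_mem_unimodularBorelInvariants`).
[cite: BurgisserEtAl2011, Prop. 5.2.1 (proof)] -/
theorem sum_prod_mul_eq_det_pow_mul_of_mem_highestWeightSpace_rectangle {N δ : ℕ}
    {y : Word N (N * δ) → ℂ}
    (hy : y ∈ highestWeightSpace (wordRep ℂ N (N * δ)) (Weight.ofPartition N (Nat.Partition.rectangle N δ)))
    {A : Matrix (Fin N) (Fin N) ℂ} (hA : A.det ≠ 0) (u : Word N (N * δ)) :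
    ∑ u', (∏ p, A (u' p) (u p)) * y u' = A.det ^ δ * y u := by
  have hAT : A.transpose.det ≠ 0 := by rwa [Matrix.det_transpose]
  set g : GL (Fin N) ℂ := Matrix.GeneralLinearGroup.mkOfDetNeZero A.transpose hAT with hg
  have hy' : y ∈ Literature.NumberTheory.DiophantineGeometry.unimodularBorelInvariants ℂ N (N * δ) := by
    rw [unimodularBorelInvariants_eq_highestWeightSpace]; exact hy
  have h := congrFun (Literature.Computability.AlgebraicComplexity.wordRep_eq_det_pow_smul_of_mem_unimodularBorelInvariants ℂ hy' g) u
  rw [wordRep_apply] at h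
  have hcoe : ((g : Matrix (Fin N) (Fin N) ℂ)) = A.transpose := rfl
  simp only [hcoe, Matrix.transpose_apply, Pi.smul_apply, smul_eq_mul, Matrix.det_transpose] at h
  exact h

/-! ### §3 Semi-invariance of two-rectangle pairings under `GL_N × GL_N × 1` -/

/-- `(A ⊗ B ⊗ 1)·s = (A ⊗ 1 ⊗ 1)·((1 ⊗ B ⊗ 1)·s)`. [folklore] -/
theorem actTensor_eq_actTensor₁_actTensor₂ {N : ℕ} (A B : Matrix (Fin N) (Fin N) ℂ)
    (s : Fin N → Fin N → Fin N → ℂ) :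
    actTensor A B (1 : Matrix (Fin N) (Fin N) ℂ) s =
      actTensor A (1 : Matrix (Fin N) (Fin N) ℂ) (1 : Matrix (Fin N) (Fin N) ℂ)
        (actTensor (1 : Matrix (Fin N) (Fin N) ℂ) B (1 : Matrix (Fin N) (Fin N) ℂ) s) := by
  rw [actTensor_actTensor, Matrix.mul_one, Matrix.one_mul, Matrix.one_mul]

/-- **Semi-invariance of two-rectangle pairings.**  If the partial functions of `f` in the first and in
the second word lie in `HW_{(δ^N)}`, then for invertible `A, B` and any `s ∈ ℂ^N ⊗ ℂ^N ⊗ ℂ^N`: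
`⟪f, ((A ⊗ B ⊗ 1)·s)^{⊗Nδ}⟫ = det(A)^δ det(B)^δ ⟪f, s^{⊗Nδ}⟫`. [cite: BurgisserEtAl2011, Prop. 5.2.1 (proof)]
[cite: BurgisserIkenmeyer2011, Prop. 3.4] -/
theorem pairing_kroneckerPow_actTensor₁₂_of_rectangle {N δ : ℕ} {f : Word3 N (N * δ) → ℂ}
    (h1 : ∀ v w, (fun u => f ((u, v), w)) ∈
      highestWeightSpace (wordRep ℂ N (N * δ)) (Weight.ofPartition N (Nat.Partition.rectangle N δ)))
    (h2 : ∀ u w, (fun v => f ((u, v), w)) ∈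
      highestWeightSpace (wordRep ℂ N (N * δ)) (Weight.ofPartition N (Nat.Partition.rectangle N δ)))
    {A B : Matrix (Fin N) (Fin N) ℂ} (hA : A.det ≠ 0) (hB : B.det ≠ 0)
    (s : Fin N → Fin N → Fin N → ℂ) :
    ∑ u, ∑ v, ∑ w, kroneckerPow (actTensor A B (1 : Matrix (Fin N) (Fin N) ℂ) s) (N * δ) u v w * f ((u, v), w) =
      A.det ^ δ * B.det ^ δ * ∑ u, ∑ v, ∑ w, kroneckerPow s (N * δ) u v w * f ((u, v), w) := by
  classical
  rw [actTensor_eq_actTensor₁_actTensor₂, kroneckerPow_actTensor₁, sum_powAct₁_mul]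
  have step1 : ∀ u v w, (∑ u', (∏ p, A (u' p) (u p)) * f ((u', v), w)) = A.det ^ δ * f ((u, v), w) :=
    fun u v w => sum_prod_mul_eq_det_pow_mul_of_mem_highestWeightSpace_rectangle (h1 v w) hA u
  simp only [step1]
  rw [sum_mul_const_mul (A.det ^ δ) (kroneckerPow (actTensor (1 : Matrix (Fin N) (Fin N) ℂ) B
    (1 : Matrix (Fin N) (Fin N) ℂ) s) (N * δ)) f, kroneckerPow_actTensor₂, sum_powAct₂_mul]
  have step2 : ∀ u v w, (∑ v', (∏ p, B (v' p) (v p)) * f ((u, v'), w)) = B.det ^ δ * f ((u, v), w) :=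
    fun u v w => sum_prod_mul_eq_det_pow_mul_of_mem_highestWeightSpace_rectangle (h2 u w) hB v
  simp only [step2]
  rw [sum_mul_const_mul (B.det ^ δ) (kroneckerPow s (N * δ)) f]
  ring

/-- The same for `f ∈ HW_{(δ^N)} ⊗ HW_{(δ^N)} ⊗ HW_χ` (any third weight `χ`). [cite: BurgisserIkenmeyer2011, Prop. 3.4] -/
theorem pairing_kroneckerPow_actTensor₁₂_of_mem_tripleHw {N δ : ℕ} {χ : Weight (Fin N)} {f : Word3 N (N * δ) → ℂ}
    (hf : f ∈ tripleHw ℂ N (N * δ) (Weight.ofPartition N (Nat.Partition.rectangle N δ))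
      (Weight.ofPartition N (Nat.Partition.rectangle N δ)) χ)
    {A B : Matrix (Fin N) (Fin N) ℂ} (hA : A.det ≠ 0) (hB : B.det ≠ 0)
    (s : Fin N → Fin N → Fin N → ℂ) :
    ∑ u, ∑ v, ∑ w, kroneckerPow (actTensor A B (1 : Matrix (Fin N) (Fin N) ℂ) s) (N * δ) u v w * f ((u, v), w) =
      A.det ^ δ * B.det ^ δ * ∑ u, ∑ v, ∑ w, kroneckerPow s (N * δ) u v w * f ((u, v), w) := by
  obtain ⟨h1, h2, -⟩ := (mem_tripleHw_iff _ _ _ f).1 hf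
  exact pairing_kroneckerPow_actTensor₁₂_of_rectangle h1 h2 hA hB s

/-! ### §4 The orbit of `⟨N⟩`: normal form through diagonal slices -/

/-- **Orbit normal form**: `(A ⊗ B ⊗ C)·⟨N⟩ = (A ⊗ B ⊗ 1)·t₀(c)` with `c i l = C l i`, where
`t₀(c) i j l = [i = j] c i l` is the diagonal slice tensor of the floor law. [folklore] -/
theorem actTensor_unitTensor_eq_actTensor_diagSlice {N : ℕ} (A B C : Matrix (Fin N) (Fin N) ℂ) :
    actTensor A B C (unitTensor ℂ N) =
      actTensor A B (1 : Matrix (Fin N) (Fin N) ℂ) (fun i j l : Fin N => if i = j then C l i else 0) := by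
  rw [diagSlice_eq_actTensor (fun i l => C l i), actTensor_actTensor, Matrix.mul_one, Matrix.mul_one,
    Matrix.one_mul]
  rfl

/-- **Two-rectangle pairings on the orbit of `⟨N⟩`**: for `f` with legs 1, 2 in `HW_{(δ^N)}`, invertible
`A, B` and ANY `C`,  `⟪f, ((A ⊗ B ⊗ C)·⟨N⟩)^{⊗Nδ}⟫ = det(A)^δ det(B)^δ ⟪f, t₀(Cᵀ-rows)^{⊗Nδ}⟫`.
[cite: BurgisserIkenmeyer2011, Prop. 3.4] -/
theorem pairing_orbit_unitTensor_of_rectangle {N δ : ℕ} {f : Word3 N (N * δ) → ℂ}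
    (h1 : ∀ v w, (fun u => f ((u, v), w)) ∈
      highestWeightSpace (wordRep ℂ N (N * δ)) (Weight.ofPartition N (Nat.Partition.rectangle N δ)))
    (h2 : ∀ u w, (fun v => f ((u, v), w)) ∈
      highestWeightSpace (wordRep ℂ N (N * δ)) (Weight.ofPartition N (Nat.Partition.rectangle N δ)))
    {A B : Matrix (Fin N) (Fin N) ℂ} (hA : A.det ≠ 0) (hB : B.det ≠ 0) (C : Matrix (Fin N) (Fin N) ℂ) :
    ∑ u, ∑ v, ∑ w, kroneckerPow (actTensor A B C (unitTensor ℂ N)) (N * δ) u v w * f ((u, v), w) =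
      A.det ^ δ * B.det ^ δ *
        ∑ u, ∑ v, ∑ w, kroneckerPow (fun i j l : Fin N => if i = j then C l i else 0) (N * δ) u v w * f ((u, v), w) := by
  rw [actTensor_unitTensor_eq_actTensor_diagSlice]
  exact pairing_kroneckerPow_actTensor₁₂_of_rectangle h1 h2 hA hB _

/-- **Completeness of diagonal slices** for two-rectangle functionals: `f` (legs 1, 2 in `HW_{(δ^N)}`)
pairs to zero with the `Nδ`-th power of EVERY point `(A ⊗ B ⊗ C)·⟨N⟩`, `A, B` invertible, `C`
arbitrary, iff it pairs to zero with the `Nδ`-th power of every diagonal slice `t₀(c)`. [folklore] -/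
theorem pairing_orbit_unitTensor_eq_zero_iff_of_rectangle {N δ : ℕ} {f : Word3 N (N * δ) → ℂ}
    (h1 : ∀ v w, (fun u => f ((u, v), w)) ∈
      highestWeightSpace (wordRep ℂ N (N * δ)) (Weight.ofPartition N (Nat.Partition.rectangle N δ)))
    (h2 : ∀ u w, (fun v => f ((u, v), w)) ∈
      highestWeightSpace (wordRep ℂ N (N * δ)) (Weight.ofPartition N (Nat.Partition.rectangle N δ))) :
    (∀ A B C : Matrix (Fin N) (Fin N) ℂ, A.det ≠ 0 → B.det ≠ 0 →
        ∑ u, ∑ v, ∑ w, kroneckerPow (actTensor A B C (unitTensor ℂ N)) (N * δ) u v w * f ((u, v), w) = 0) ↔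
      ∀ c : Fin N → Fin N → ℂ,
        ∑ u, ∑ v, ∑ w, kroneckerPow (fun i j l : Fin N => if i = j then c i l else 0) (N * δ) u v w * f ((u, v), w) = 0 := by
  constructor
  · intro h c
    have h1' := h 1 1 (Matrix.of fun l i => c i l) (by simp) (by simp)
    rwa [← diagSlice_eq_actTensor c] at h1'
  · intro h A B C hA hB
    rw [pairing_orbit_unitTensor_of_rectangle h1 h2 hA hB C, h (fun i l => C l i), mul_zero]

/-! ### §5 The block-sign functionals: orbit pairings are signed block sums -/

/-- **Orbit pairings of `ζ_e ⊗ ζ_{e'} ⊗ M` are signed block sums.**  For block structures `e, e'`,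
any third-leg functional `M`, invertible `A, B` and any `C`:
`⟪ζ_e ⊗ ζ_{e'} ⊗ M, ((A ⊗ B ⊗ C)·⟨N⟩)^{⊗Nδ}⟫ =
  det(A)^δ det(B)^δ ∑_{σ ∈ S_N^δ} sgn σ · ζ_{e'}(w_σ) · ∑_w M(w) ∏_q C_{w(q), w_σ(q)}`
(the floor law `pairing_diagSlice_blockSign_blockSign` transported along the orbit).
[cite: BurgisserIkenmeyer2017, §5 (eq. (5.2))] [cite: BurgisserIkenmeyer2011, Prop. 3.4] -/
theorem pairing_orbit_unitTensor_blockSign_blockSign {N δ : ℕ} (e e' : Fin (N * δ) ≃ Fin δ × Fin N)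
    (M : Word N (N * δ) → ℂ) {A B : Matrix (Fin N) (Fin N) ℂ} (hA : A.det ≠ 0) (hB : B.det ≠ 0)
    (C : Matrix (Fin N) (Fin N) ℂ) :
    ∑ u, ∑ v, ∑ w, kroneckerPow (actTensor A B C (unitTensor ℂ N)) (N * δ) u v w *
        (wordBlockSign ℂ e u * wordBlockSign ℂ e' v * M w) =
      A.det ^ δ * B.det ^ δ *
        ∑ σ : Fin δ → Equiv.Perm (Fin N), (∏ a, ((Equiv.Perm.sign (σ a) : ℤ) : ℂ)) *
          (wordBlockSign ℂ e' (fun q => σ (e q).1 (e q).2) *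
            ∑ w, M w * ∏ q, C (w q) (σ (e q).1 (e q).2)) := by
  set F : Word3 N (N * δ) → ℂ := fun t => wordBlockSign ℂ e t.1.1 * wordBlockSign ℂ e' t.1.2 * M t.2 with hF
  have h1 : ∀ v w, (fun u => F ((u, v), w)) ∈
      highestWeightSpace (wordRep ℂ N (N * δ)) (Weight.ofPartition N (Nat.Partition.rectangle N δ)) := by
    intro v w
    have := Submodule.smul_mem _ (wordBlockSign ℂ e' v * M w) (wordBlockSign_mem_highestWeightSpace (k := ℂ) e)
    convert this using 1
    funext u; simp only [hF, Pi.smul_apply, smul_eq_mul]; ring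
  have h2 : ∀ u w, (fun v => F ((u, v), w)) ∈
      highestWeightSpace (wordRep ℂ N (N * δ)) (Weight.ofPartition N (Nat.Partition.rectangle N δ)) := by
    intro u w
    have := Submodule.smul_mem _ (wordBlockSign ℂ e u * M w) (wordBlockSign_mem_highestWeightSpace (k := ℂ) e')
    convert this using 1
    funext v; simp only [hF, Pi.smul_apply, smul_eq_mul]; ring
  have h := pairing_orbit_unitTensor_of_rectangle (f := F) h1 h2 hA hB C
  have hL : ∑ u, ∑ v, ∑ w, kroneckerPow (actTensor A B C (unitTensor ℂ N)) (N * δ) u v w *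
        (wordBlockSign ℂ e u * wordBlockSign ℂ e' v * M w) =
      ∑ u, ∑ v, ∑ w, kroneckerPow (actTensor A B C (unitTensor ℂ N)) (N * δ) u v w * F ((u, v), w) := rfl
  have hR : ∑ u, ∑ v, ∑ w, kroneckerPow (fun i j l : Fin N => if i = j then C l i else 0) (N * δ) u v w *
        (wordBlockSign ℂ e u * wordBlockSign ℂ e' v * M w) =
      ∑ u, ∑ v, ∑ w, kroneckerPow (fun i j l : Fin N => if i = j then C l i else 0) (N * δ) u v w *
        F ((u, v), w) := rfl
  rw [hL, h, ← hR, pairing_diagSlice_blockSign_blockSign e e' M (fun i l => C l i)]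

/-- Hence, on the orbit, **vanishing is decided by the signed block sum**: for invertible `A, B` the
pairing `⟪ζ_e ⊗ ζ_{e'} ⊗ M, ((A ⊗ B ⊗ C)·⟨N⟩)^{⊗Nδ}⟫` is non-zero iff the signed block sum at
`c = (C_{l i})_{i l}` is. [folklore] -/
theorem pairing_orbit_unitTensor_blockSign_blockSign_ne_zero_iff {N δ : ℕ} (e e' : Fin (N * δ) ≃ Fin δ × Fin N)
    (M : Word N (N * δ) → ℂ) {A B : Matrix (Fin N) (Fin N) ℂ} (hA : A.det ≠ 0) (hB : B.det ≠ 0)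
    (C : Matrix (Fin N) (Fin N) ℂ) :
    ∑ u, ∑ v, ∑ w, kroneckerPow (actTensor A B C (unitTensor ℂ N)) (N * δ) u v w *
        (wordBlockSign ℂ e u * wordBlockSign ℂ e' v * M w) ≠ 0 ↔
      ∑ σ : Fin δ → Equiv.Perm (Fin N), (∏ a, ((Equiv.Perm.sign (σ a) : ℤ) : ℂ)) *
          (wordBlockSign ℂ e' (fun q => σ (e q).1 (e q).2) *
            ∑ w, M w * ∏ q, C (w q) (σ (e q).1 (e q).2)) ≠ 0 := by
  rw [pairing_orbit_unitTensor_blockSign_blockSign e e' M hA hB C]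
  simp [hA, hB]

end Summit.MatrixMultiplication.MatrixMultiplication.Theorems.ObstructionCalculus
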